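import Summits.BirchSwinnertonDyer.Rank1Residual.F1Sign2.DescentSignAtTwo
import Literature.NumberTheory.EllipticCurves.ModularityVersionApProofs
import HarnessLib

/-!
# Cell `bsd-f1-sign2` — analytic / GZ lens (seat `-an`, g5): AN-14G THE GENUS LAW behind the EGG SYMBOL

STATEMENTS + one kernel-checked glue theorem; nothing asserted (typer filing of the planner's sketch, see the end of this docstring).  Context (MEMO-an v1.11 §2
AN-14): for a rank-one optimal curve `E = E_f` (`f|W_N = f`, `L(f,1) = 0`) and a Heegner field `K`, complex
conjugation acts on the Heegner points `x_𝔞 ∈ X₀(N)(H_K)` by `x̄_𝔞 = w_N x_{𝔞*}` with `[𝔞*] = [𝔞]⁻¹[𝔫]`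
(Gross 1984 §5; Watkins 2005 Thm 2.8), so the lift `Φ(τ_𝔞) = Σ a_n/n · q^n` satisfies
`conj Φ(τ_𝔞) − Φ(τ_{𝔞*}) = λ(γ_𝔞) ∈ Λ_f` EXACTLY (`γ_𝔞 ∈ Γ₀(N)`), and the EGG BIT of `y_K = Σ_𝔞 φ(x_𝔞) ∈ E(ℚ)`
is `b(E,K) = Σ_𝔞 x⁻(γ_𝔞) mod 2 = #{[𝔞] : [𝔞]² = [𝔫], φ(x_𝔞) ∉ E⁰(ℝ)} mod 2` — only the SELF-PAIRED classes
(`[𝔞]² = [𝔫]`, whose `φ(x_𝔞)` are REAL points) carry the parity.  Self-paired classes exist iff `[𝔫]` lies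
in the principal genus of `Cl_K`, i.e. iff every genus character `χ_q(𝔫) = (q*/N) = (N/q)` (`q ∣ d_K`) is `+1`.
The three `Prop`s below are the ELEMENTARY law making that automatic on the AN-13 locus:

* `TamOddSquareLaw` (G1): `Δ > 0` and `∏ c_ℓ` odd ⇒ `N · Δ_min` is a square (Ogg–Saito `f_ℓ = v_ℓ(Δ) + 1 − m_ℓ`
  and the Kodaira table: `c_ℓ` odd ⇒ `m_ℓ` odd ⇒ `f_ℓ ≡ v_ℓ(Δ) (mod 2)` at every `ℓ`).
* `OddTraceSquareResidueLaw` (G2): `q` odd of good reduction with `a_q` odd ⇒ `(Δ/q) = +1` (`E(𝔽_q)[2] = 0` ⇒ the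
  2-division cubic is irreducible over `𝔽_q` ⇒ cyclic Galois group ⇒ its discriminant `16Δ` is a square mod `q`).
* `AdmissiblePrincipalGenusLaw` (G3): `Δ > 0`, `∏ c_ℓ` odd, `d` descent-admissible ⇒ `(N/q) = +1` for every prime
  `q ∣ d`, i.e. `[𝔫] ∈ Cl_K²` (census g5/an13_genus: 0 of 2 301 admissible Tam-odd rows violate it, against
  533 of 2 383 admissible Tam-even rows with some `(N/q) = −1`).

`admissiblePrincipalGenusLaw_of` : G1 → G2 → G3 is kernel-checked below (pure Jacobi-symbol algebra plus the tree's
`dvd_conductorNorm_iff_not_hasGoodReductionAtPrime`).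

TYPER FILING (seat `bsd-f1-sign2-ty` g2, D-ty-11; CANDIDATES.md rows AN-14G₁ / AN-14G₂ / AN-14G): bodies VERBATIM from
`HOME/MEMO-an-data/g5/EggSymbolGenus.lean` c4da901c286146da (-an g5, MEMO-an v1.11 3078089d55c7132d §2 AN-14; rc 0 / 0 warn /
0 sorry, check json `g5/EggSymbolGenus_check.json` 69cb17b5f0d16c3b); rows `g5/CANDIDATES-rows-an-v111.md` 664702f3e6eb7347.
The three Props are SUPPORT-grade (G1/G2 elementary THEOREMS on paper, in print as ingredients — provable support, proofs
welcome in a sibling `…Proofs.lean`; G3 the genus law with census 2 301/2 301, PROVED here from G1 ∧ G2); plain `def`s (hypotheses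
threaded explicitly), nothing asserted, no named fact. REF1 (D-ref1-an-8,
asked 20:59:39Z) = REF1-AUDIT-v1 §31 (ff0d73276419a055, 2026-08-27T21:38:02Z; evidence `HOME/REF1-data/b28/`, kit j291175): as-is rc 0,
A1 rc 0, BC7 CLEAN; G1 `TamOddSquareLaw` / G2 `OddTraceSquareResidueLaw` are THEOREMS on paper (Ogg–Saito `f_ℓ = v_ℓ(Δ_min) + 1 − m_ℓ`
at every `ℓ` + the Kodaira–Néron table: `c_ℓ` odd ⇒ `m_ℓ` odd ⇒ `f_ℓ ≡ v_ℓ(Δ) (mod 2)`; an irreducible cubic over `𝔽_q` has square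
discriminant) with an INDEPENDENT PARI engine on all 64 687 curves `N < 10⁴` (G1 3 260/3 260, mechanism 104 430/104 430 bad places,
G2 818 477/818 477, 0 violations; Tam-even control 25 257/26 914 non-square) — «file as provable support»; G3 kernel-checked from
G1 ∧ G2. REF2 v15 (4f5319fb6d62b9c7, 21:16:33Z) (B) E4: TEXTBOOK INGREDIENTS, assembly one line each, the sentence not found in
print (Tate's algorithm table [SilvermanATAEC1994 IV.9]; cubic discriminant / GJPST 2009 Prop 2.6; Gauss genus theory, Tian 2012 §2
nearest in corpus); its «semistability caution for G1 at ℓ ∈ {2, 3}» is settled by REF1 §31 (Ogg–Saito holds at every ℓ [Saito1988];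
0/3 260 exceptions incl. all additive-at-2/3 Tam-odd curves `N < 10⁴`); beyond-print no. Helper
namespace `…F1Sign2.EggSymbol` kept as in the sketch. PARTITION: none moved; beyond-print theorem: no.
bears_on: `stmt-BirchSwinnertonDyer-19099` (line `egg-kolyvagin-two`, third door for `stub_kolyvaginTwo` via the egg symbol AN-14).
LANDING NOTE (-ty g14, 2026-08-29T01:5xZ; text only, statements untouched; LEAD bsd-line-fkl-p1 g18 01:29:44Z): **G₂ `OddTraceSquareResidueLaw` IS NOW A TREE THEOREM** —
`Summit.BirchSwinnertonDyer.BirchSwinnertonDyer.Theorems.RankOneAtTwoOneDoor`.oddTraceSquareResidueLaw_holds : EggSymbol.OddTraceSquareResidueLaw` (an odd good prime `q` with `a_q` odd has `(Δ_W/q) = +1`: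
Frobenius is a `3`-cycle on `W[2]`, an even permutation; read off `TwoAdicTwistConverse.legendreSym_discr_eq_one_of_odd_frobeniusTrace` through `Δ.num = Δ_min`), in
`Summits/BirchSwinnertonDyer/BirchSwinnertonDyer/Theorems/ByReductionTypeAtTwoRankOneAtTwoBigImageOddLocalOneDoorTranspositionParity.lean` (p685553 ACCEPTED, commit 7c3ba627e036, std axioms — re-checked by the typer);
hence **AN-14G ⟸ G₁ alone**: `….admissiblePrincipalGenusLaw_of_tamOddSquareLaw : TamOddSquareLaw → AdmissiblePrincipalGenusLaw` (this file's `admissiblePrincipalGenusLaw_of` with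
G₂ discharged). Consumers: feed `(hG2 : OddTraceSquareResidueLaw)` with `oddTraceSquareResidueLaw_holds`. STILL OPEN as typed: G₁ `TamOddSquareLaw` (theorem on paper per REF1 §31:
Ogg–Saito + Kodaira–Néron). CANDIDATES.md: AN-14G₂ → TREE THEOREM. PARTITION: none; beyond-print theorem: no; BSD not proved; no item closed.

LANDING NOTE 2 (-ty g14, 2026-08-29T04:0xZ; text only, statements untouched; LEAD bsd-line-fkl-p1 g19 02:53:15Z): **AN-14G₁ `TamOddSquareLaw` AND AN-14G
`AdmissiblePrincipalGenusLaw` ARE NOW TREE THEOREMS** — `Summit.BirchSwinnertonDyer.BirchSwinnertonDyer.Theorems.RankOneAtTwoOneDoor.tamOddSquareLaw_holds : TamOddSquareLaw`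
and `….admissiblePrincipalGenusLaw_holds : AdmissiblePrincipalGenusLaw` (fkl-p1 g19, p687229 ACCEPTED, `--supports 23715 --as helper`, file
`Summits/BirchSwinnertonDyer/BirchSwinnertonDyer/Theorems/ByReductionTypeAtTwoRankOneAtTwoBigImageOddLocalOneDoorTamOddSquare.lean`; std axioms `propext` /
`Classical.choice` / `Quot.sound` re-checked by the typer with `lean check`): G₁ is the b2b cell's `Supersingular.exists_conductorNorm_mul_abs_minimalDiscriminantInt_eq_sq`
read through `num_Δ_eq_minimalDiscriminantInt`; AN-14G = this file's `admissiblePrincipalGenusLaw_of` fed with G₁ and G₂ (`oddTraceSquareResidueLaw_holds`, LANDING NOTE 1).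
Consumers: feed `(hG1 : TamOddSquareLaw)` with `tamOddSquareLaw_holds` and `(hG : AdmissiblePrincipalGenusLaw)` with `admissiblePrincipalGenusLaw_holds`.  NOTHING in this
file is open any more: all three support rows G₁, G₂, AN-14G are tree theorems (elementary: Ogg–Saito + Kodaira–Néron + quadratic reciprocity; beyond-print theorem: no).
PARTITION: none; BSD not proved; no item closed; CANDIDATES.md rows AN-14G₁ / AN-14G marked «TREE THEOREM».
-/

namespace Summit.BirchSwinnertonDyer.Rank1Residual.F1Sign2.EggSymbol

open WeierstrassCurve Summit.BirchSwinnertonDyer.Rank1Residual.F1Sign2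

set_option autoImplicit false

/-- **AN-14G₁ `TamOddSquareLaw`** (support-grade, elementary from Ogg–Saito + Kodaira–Néron table): for a globally
minimal `W/ℚ` with `Δ > 0` and `∏_ℓ c_ℓ` odd, `N_W · Δ_W` is a perfect square. [cite: Silverman1994, IV.9.4 Table 4.1
& IV.11.1 (Ogg's formula); Saito1988] -/
def TamOddSquareLaw : Prop :=
  ∀ (W : WeierstrassCurve ℚ) [W.IsElliptic] [W.IsGloballyMinimal], 0 < W.Δ → ¬ 2 ∣ W.tamagawaProduct →
    IsSquare ((W.conductorNorm ℤ : ℤ) * W.Δ.num)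

/-- **AN-14G₂ `OddTraceSquareResidueLaw`** (support-grade, elementary): an odd prime `q` of good reduction with
`a_q(W)` odd has `(Δ_W / q) = +1`. [cite: Silverman2009, III.1 & V; elementary] -/
def OddTraceSquareResidueLaw : Prop :=
  ∀ (W : WeierstrassCurve ℚ) [W.IsElliptic] [W.IsGloballyMinimal] (q : ℕ), q.Prime → q ≠ 2 →
    (∀ _h : Fact q.Prime, W.HasGoodReductionAtPrime q) → Odd (W.frobeniusTrace q) →
    jacobiSym W.Δ.num q = 1

/-- **AN-14G `AdmissiblePrincipalGenusLaw`** (support-grade; the genus law behind the egg symbol): `Δ > 0`,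
`∏ c_ℓ` odd and `d` descent-admissible ⇒ `(N_W / q) = +1` for every prime `q ∣ d` — equivalently the class of
`𝔫` is a square in `Cl(ℚ(√d))`, so SELF-PAIRED Heegner classes exist.  Census (g5): 2 301 / 2 301. -/
def AdmissiblePrincipalGenusLaw : Prop :=
  ∀ (W : WeierstrassCurve ℚ) [W.IsElliptic] [W.IsGloballyMinimal], 0 < W.Δ → ¬ 2 ∣ W.tamagawaProduct →
    ∀ d : ℤ, DescAdmissible W d → ∀ q : ℕ, q.Prime → (q : ℤ) ∣ d → jacobiSym (W.conductorNorm ℤ : ℤ) q = 1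

/-- Glue: G1 ∧ G2 ⇒ G3 (Jacobi-symbol algebra: `(N/q)·(Δ/q) = (m²/q) ∈ {0,1}`, and `(N/q) = 0` would put `q ∣ N`,
contradicting good reduction at `q`). -/
theorem admissiblePrincipalGenusLaw_of (h1 : TamOddSquareLaw) (h2 : OddTraceSquareResidueLaw) :
    AdmissiblePrincipalGenusLaw := by
  intro W _ _ hΔ hTam d hAdm q hq hqd
  obtain ⟨_, _, hd8, hgood, _⟩ := hAdm
  have hq2 : q ≠ 2 := by
    rintro rfl
    obtain ⟨k, hk⟩ := hqd
    omega
  obtain ⟨hgq, hodd⟩ := hgood q hq hqd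
  have hJΔ : jacobiSym W.Δ.num q = 1 := h2 W q hq hq2 hgq hodd
  obtain ⟨m, hm⟩ := h1 W hΔ hTam
  -- (N Δ / q) = (m m / q) = (m/q)^2
  have hmul : jacobiSym ((W.conductorNorm ℤ : ℤ) * W.Δ.num) q
      = jacobiSym (W.conductorNorm ℤ : ℤ) q * jacobiSym W.Δ.num q := jacobiSym.mul_left _ _ _
  rw [hm, jacobiSym.mul_left, hJΔ, mul_one] at hmul
  -- so (N/q) = (m/q)^2 ≥ 0; rule out 0 and −1
  haveI : Fact q.Prime := ⟨hq⟩
  have hN0 : jacobiSym (W.conductorNorm ℤ : ℤ) q ≠ 0 := by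
    intro h0
    rw [jacobiSym.eq_zero_iff] at h0
    obtain ⟨_, hg⟩ := h0
    apply hg
    rw [Int.gcd_natCast_natCast]
    have hcop : Nat.Coprime q (W.conductorNorm ℤ) := by
      rw [Nat.Prime.coprime_iff_not_dvd hq]
      intro hdvd
      exact (W.dvd_conductorNorm_iff_not_hasGoodReductionAtPrime q).1 hdvd (hgq ⟨hq⟩)
    exact Nat.Coprime.symm hcop
  rcases jacobiSym.trichotomy (W.conductorNorm ℤ : ℤ) q with h | h | h
  · exact absurd h hN0
  · exact h
  · exfalso
    have hsq : (0 : ℤ) ≤ jacobiSym m q * jacobiSym m q := mul_self_nonneg _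
    rw [hmul, h] at hsq
    norm_num at hsq

end Summit.BirchSwinnertonDyer.Rank1Residual.F1Sign2.EggSymbol
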